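import Summits.AtomisticToContinuum.HydrodynamicLimit.Theorems.OneFlightGossipEngineEquilibriumHeatFluxVarianceDecayStatics
import Summits.AtomisticToContinuum.HydrodynamicLimit.Theorems.BoltzmannGreenKubo.Negative.TimeAverage

/-!
# A-priori bound for the window-averaged fast heat flux (support file 2 for C4)

Support lemmas for the route item `EquilibriumHeatFluxVarianceDecay` (stmt-AtomisticToContinuum-9532, route
OneFlightGossipEngine). Under the centred canonical Gibbs law `λ = localGibbsLaw σ a₀ 0 θ₀ N Φ` (`σ ≤ 1/2`, constants
`a₀, θ₀ > 0`), for every hard-sphere flow `Φ`, every window `w > 0` and every continuous `φ` with `|φ| ≤ K`: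
`(N+1) · ∫ Ȳ² dλ ≤ K² 𝐦₂[θ₀]`, `Ȳ(z) = (N+1)⁻¹ Σᵢ w⁻¹∫₀ʷ φ(xᵢ(r)) 𝐡[θ₀, vᵢ(r)] dr`
(`succ_mul_lintegral_windowAvg_sq_le`): linearity of the window average, Jensen in time, Fubini + stationarity of
`λ` under every `Φ_r` (`BoltzmannGreenKubo.Negative.TimeAverage/Stationarity`), and the static bound of file 1.
Consequences in the exact shape of the item: `item_term_le`, `item_limsup_le`, `item_limsup_ne_top` — the item's
`limsup_N` is `≤ K² 𝐦₂[θ₀] < ⊤` for EVERY `τ > 0`, so the `(N+1)`-normalisation is critical and the whole content of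
the item is the `τ → ∞` decay (an open problem: N-uniform decay of equilibrium time correlations of deterministic
hard spheres at fixed density). prover-pitem-stmt-AtomisticToContinuum-9532-0.
-/

noncomputable section
namespace Summit.AtomisticToContinuum.HydrodynamicLimit.Theorems

open MeasureTheory ProbabilityTheory Filter Topology Set
open Literature.Analysis.FluidPDE Literature.MathematicalPhysics.KineticTheory
open scoped InnerProductSpace ENNReal
open BoltzmannGreenKuboOrthMomentum

namespace OneFlightGossipEngineHeatFlux

section Apriori

variable {a₀ θ₀ σ : ℝ} {N : ℕ}

/-! ## Integrability of the heat-flux observables under the canonical law -/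

/-- `h_θ₀(vᵢ) ∈ L²(λ)`. [folklore] -/
theorem memLp_two_hf_coord (ha : 0 < a₀) (hθ : 0 < θ₀) (hσ : σ ≤ 1 / 2) (N : ℕ)
    (Φ : HardSphereFlow (Torus.geometry (Fin 3)) (hsDiameter σ N) (N + 1)) (i : Fin (N + 1)) :
    MemLp (fun z : Config (N + 1) (Fin 3) T3 => 𝐡[θ₀, (z i).2]) 2
      (localGibbsLaw σ (fun _ => a₀) (fun _ => 0) (fun _ => θ₀) N Φ) := by
  have hm : Measurable fun z : Config (N + 1) (Fin 3) T3 => 𝐡[θ₀, (z i).2] :=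
    (measurable_hf θ₀).comp (measurable_pi_apply i).snd
  rw [memLp_two_iff_integrable_sq hm.aestronglyMeasurable]
  refine ⟨(hm.pow_const 2).aestronglyMeasurable, ?_⟩
  rw [hasFiniteIntegral_iff_ofReal (Eventually.of_forall fun z => sq_nonneg _), lintegral_hf_sq_eq ha hθ hσ N Φ i]
  exact ENNReal.ofReal_lt_top

/-- `Fᵢ = φ(xᵢ) h_θ₀(vᵢ) ∈ L²(λ)` for bounded continuous `φ`. [folklore] -/
theorem memLp_two_F (ha : 0 < a₀) (hθ : 0 < θ₀) (hσ : σ ≤ 1 / 2) (N : ℕ)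
    (Φ : HardSphereFlow (Torus.geometry (Fin 3)) (hsDiameter σ N) (N + 1))
    {φ : T3 → ℝ} (hφ : Continuous φ) {K : ℝ} (hφK : ∀ y, |φ y| ≤ K) (i : Fin (N + 1)) :
    MemLp (fun z : Config (N + 1) (Fin 3) T3 => φ (z i).1 * 𝐡[θ₀, (z i).2]) 2
      (localGibbsLaw σ (fun _ => a₀) (fun _ => 0) (fun _ => θ₀) N Φ) := by
  have hm : Measurable fun z : Config (N + 1) (Fin 3) T3 => φ (z i).1 * 𝐡[θ₀, (z i).2] :=
    (hφ.measurable.comp (measurable_pi_apply i).fst).mul ((measurable_hf θ₀).comp (measurable_pi_apply i).snd)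
  refine (memLp_two_hf_coord ha hθ hσ N Φ i).of_le_mul (c := K) hm.aestronglyMeasurable
    (Eventually.of_forall fun z => ?_)
  rw [Real.norm_eq_abs, Real.norm_eq_abs, abs_mul]
  exact mul_le_mul_of_nonneg_right (hφK _) (abs_nonneg _)

/-- `Fᵢ ∈ L¹(λ)`. [folklore] -/
theorem integrable_F (ha : 0 < a₀) (hθ : 0 < θ₀) (hσ : σ ≤ 1 / 2) (N : ℕ)
    (Φ : HardSphereFlow (Torus.geometry (Fin 3)) (hsDiameter σ N) (N + 1))
    {φ : T3 → ℝ} (hφ : Continuous φ) {K : ℝ} (hφK : ∀ y, |φ y| ≤ K) (i : Fin (N + 1)) :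
    Integrable (fun z : Config (N + 1) (Fin 3) T3 => φ (z i).1 * 𝐡[θ₀, (z i).2])
      (localGibbsLaw σ (fun _ => a₀) (fun _ => 0) (fun _ => θ₀) N Φ) := by
  haveI : IsProbabilityMeasure (localGibbsLaw σ (fun _ => a₀) (fun _ => (0 : V3)) (fun _ => θ₀) N Φ) :=
    isProbabilityMeasure_localGibbsLaw continuous_const continuous_const continuous_const
      (fun _ => ha) (fun _ => hθ) hσ N Φ
  exact (memLp_two_F ha hθ hσ N Φ hφ hφK i).integrable one_le_two

/-- `Y ∈ L²(λ)`. [folklore] -/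
theorem memLp_two_Yobs (ha : 0 < a₀) (hθ : 0 < θ₀) (hσ : σ ≤ 1 / 2) (N : ℕ)
    (Φ : HardSphereFlow (Torus.geometry (Fin 3)) (hsDiameter σ N) (N + 1))
    {φ : T3 → ℝ} (hφ : Continuous φ) {K : ℝ} (hφK : ∀ y, |φ y| ≤ K) :
    MemLp ((fun z : Config (N + 1) (Fin 3) T3 => 𝐘[N, θ₀, φ, z])) 2 (localGibbsLaw σ (fun _ => a₀) (fun _ => 0) (fun _ => θ₀) N Φ) := by
  exact (memLp_finsetSum _ fun i _ => memLp_two_F ha hθ hσ N Φ hφ hφK i).const_mul _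

/-- `Y ∈ L¹(λ)`. [folklore] -/
theorem integrable_Yobs (ha : 0 < a₀) (hθ : 0 < θ₀) (hσ : σ ≤ 1 / 2) (N : ℕ)
    (Φ : HardSphereFlow (Torus.geometry (Fin 3)) (hsDiameter σ N) (N + 1))
    {φ : T3 → ℝ} (hφ : Continuous φ) {K : ℝ} (hφK : ∀ y, |φ y| ≤ K) :
    Integrable ((fun z : Config (N + 1) (Fin 3) T3 => 𝐘[N, θ₀, φ, z])) (localGibbsLaw σ (fun _ => a₀) (fun _ => 0) (fun _ => θ₀) N Φ) := by
  haveI : IsProbabilityMeasure (localGibbsLaw σ (fun _ => a₀) (fun _ => (0 : V3)) (fun _ => θ₀) N Φ) :=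
    isProbabilityMeasure_localGibbsLaw continuous_const continuous_const continuous_const
      (fun _ => ha) (fun _ => hθ) hσ N Φ
  exact (memLp_two_Yobs ha hθ hσ N Φ hφ hφK).integrable one_le_two

/-- `Y² ∈ L¹(λ)`. [folklore] -/
theorem integrable_Yobs_sq (ha : 0 < a₀) (hθ : 0 < θ₀) (hσ : σ ≤ 1 / 2) (N : ℕ)
    (Φ : HardSphereFlow (Torus.geometry (Fin 3)) (hsDiameter σ N) (N + 1))
    {φ : T3 → ℝ} (hφ : Continuous φ) {K : ℝ} (hφK : ∀ y, |φ y| ≤ K) :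
    Integrable (fun z : Config (N + 1) (Fin 3) T3 => 𝐘[N, θ₀, φ, z] ^ 2) (localGibbsLaw σ (fun _ => a₀) (fun _ => 0) (fun _ => θ₀) N Φ) :=
  (memLp_two_iff_integrable_sq (measurable_Yobs θ₀ hφ).aestronglyMeasurable).1 (memLp_two_Yobs ha hθ hσ N Φ hφ hφK)

/-! ## Time averages along the flow: linearity and Jensen, almost everywhere -/

/-- For `λ`-a.e. initial datum, every `r ↦ Fᵢ(Φ_r z)` is integrable on the window `(0, w]`. [folklore] -/
theorem ae_integrableOn_F_flow (ha : 0 < a₀) (hθ : 0 < θ₀) (hσ : σ ≤ 1 / 2) (N : ℕ)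
    (Φ : HardSphereFlow (Torus.geometry (Fin 3)) (hsDiameter σ N) (N + 1))
    {φ : T3 → ℝ} (hφ : Continuous φ) {K : ℝ} (hφK : ∀ y, |φ y| ≤ K) (w : ℝ) :
    ∀ᵐ z ∂(localGibbsLaw σ (fun _ => a₀) (fun _ => 0) (fun _ => θ₀) N Φ), ∀ i : Fin (N + 1),
      Integrable (fun r => φ (Φ.flow r z i).1 * 𝐡[θ₀, (Φ.flow r z i).2]) (volume.restrict (Ioc (0 : ℝ) w)) := by
  haveI : IsProbabilityMeasure (localGibbsLaw σ (fun _ => a₀) (fun _ => (0 : V3)) (fun _ => θ₀) N Φ) :=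
    isProbabilityMeasure_localGibbsLaw continuous_const continuous_const continuous_const
      (fun _ => ha) (fun _ => hθ) hσ N Φ
  rw [ae_all_iff]
  intro i
  have hm : Measurable fun z : Config (N + 1) (Fin 3) T3 => φ (z i).1 * 𝐡[θ₀, (z i).2] :=
    (hφ.measurable.comp (measurable_pi_apply i).fst).mul ((measurable_hf θ₀).comp (measurable_pi_apply i).snd)
  exact (integrable_comp_flow_prod a₀ θ₀ 0 Φ hm (integrable_F ha hθ hσ N Φ hφ hφK i) w).prod_left_ae

/-- For `λ`-a.e. initial datum, `r ↦ Y(Φ_r z)` and `r ↦ Y(Φ_r z)²` are integrable on `(0, w]`. [folklore] -/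
theorem ae_integrableOn_Yobs_flow (ha : 0 < a₀) (hθ : 0 < θ₀) (hσ : σ ≤ 1 / 2) (N : ℕ)
    (Φ : HardSphereFlow (Torus.geometry (Fin 3)) (hsDiameter σ N) (N + 1))
    {φ : T3 → ℝ} (hφ : Continuous φ) {K : ℝ} (hφK : ∀ y, |φ y| ≤ K) (w : ℝ) :
    ∀ᵐ z ∂(localGibbsLaw σ (fun _ => a₀) (fun _ => 0) (fun _ => θ₀) N Φ),
      Integrable (fun r => 𝐘[N, θ₀, φ, Φ.flow r z]) (volume.restrict (Ioc (0 : ℝ) w)) ∧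
      Integrable (fun r => 𝐘[N, θ₀, φ, Φ.flow r z] ^ 2) (volume.restrict (Ioc (0 : ℝ) w)) := by
  haveI : IsProbabilityMeasure (localGibbsLaw σ (fun _ => a₀) (fun _ => (0 : V3)) (fun _ => θ₀) N Φ) :=
    isProbabilityMeasure_localGibbsLaw continuous_const continuous_const continuous_const
      (fun _ => ha) (fun _ => hθ) hσ N Φ
  have h1 := (integrable_comp_flow_prod a₀ θ₀ 0 Φ (measurable_Yobs θ₀ hφ)
    (integrable_Yobs ha hθ hσ N Φ hφ hφK) w).prod_left_ae
  have h2 := (integrable_comp_flow_prod a₀ θ₀ 0 Φ ((measurable_Yobs θ₀ hφ).pow_const 2)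
    (integrable_Yobs_sq ha hθ hσ N Φ hφ hφK) w).prod_left_ae
  filter_upwards [h1, h2] with z hz1 hz2
  exact ⟨hz1, hz2⟩

/-- **Linearity of the window average** (a.e.): the item's per-particle sum of window averages is the window
average of `Y` along the orbit. [folklore] -/
theorem ae_windowSum_eq (ha : 0 < a₀) (hθ : 0 < θ₀) (hσ : σ ≤ 1 / 2) (N : ℕ)
    (Φ : HardSphereFlow (Torus.geometry (Fin 3)) (hsDiameter σ N) (N + 1))
    {φ : T3 → ℝ} (hφ : Continuous φ) {K : ℝ} (hφK : ∀ y, |φ y| ≤ K) {w : ℝ} (hw : 0 ≤ w) :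
    ∀ᵐ z ∂(localGibbsLaw σ (fun _ => a₀) (fun _ => 0) (fun _ => θ₀) N Φ),
      ((N : ℝ) + 1)⁻¹ * ∑ i : Fin (N + 1), w⁻¹ * ∫ r in (0 : ℝ)..w, φ (Φ.flow r z i).1 * 𝐡[θ₀, (Φ.flow r z i).2] =
        w⁻¹ * ∫ r in (0 : ℝ)..w, 𝐘[N, θ₀, φ, Φ.flow r z] := by
  filter_upwards [ae_integrableOn_F_flow ha hθ hσ N Φ hφ hφK w] with z hz
  have hint : ∀ i ∈ (Finset.univ : Finset (Fin (N + 1))),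
      IntervalIntegrable (fun r => φ (Φ.flow r z i).1 * 𝐡[θ₀, (Φ.flow r z i).2]) volume 0 w := fun i _ =>
    (intervalIntegrable_iff_integrableOn_Ioc_of_le hw).2 (hz i)
  rw [intervalIntegral.integral_const_mul, intervalIntegral.integral_finsetSum hint, ← Finset.mul_sum]
  ring

/-- **Jensen in time** (a.e.): `(w⁻¹∫₀ʷ Y(Φ_r z) dr)² ≤ w⁻¹∫₀ʷ Y(Φ_r z)² dr`. [folklore] -/
theorem ae_windowAvg_sq_le (ha : 0 < a₀) (hθ : 0 < θ₀) (hσ : σ ≤ 1 / 2) (N : ℕ)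
    (Φ : HardSphereFlow (Torus.geometry (Fin 3)) (hsDiameter σ N) (N + 1))
    {φ : T3 → ℝ} (hφ : Continuous φ) {K : ℝ} (hφK : ∀ y, |φ y| ≤ K) {w : ℝ} (hw : 0 < w) :
    ∀ᵐ z ∂(localGibbsLaw σ (fun _ => a₀) (fun _ => 0) (fun _ => θ₀) N Φ),
      (w⁻¹ * ∫ r in (0 : ℝ)..w, 𝐘[N, θ₀, φ, Φ.flow r z]) ^ 2 ≤
        w⁻¹ * ∫ r in (0 : ℝ)..w, 𝐘[N, θ₀, φ, Φ.flow r z] ^ 2 := by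
  set μ : Measure ℝ := volume.restrict (Ioc (0 : ℝ) w) with hμ
  haveI : IsFiniteMeasure μ := ⟨by simp [hμ, Real.volume_Ioc]⟩
  haveI : NeZero μ := ⟨by
    intro h0
    have h1 : μ univ = 0 := by rw [h0]; rfl
    rw [hμ, Measure.restrict_apply_univ, Real.volume_Ioc, sub_zero, ENNReal.ofReal_eq_zero] at h1
    linarith⟩
  have havg : ∀ f : ℝ → ℝ, ⨍ r, f r ∂μ = w⁻¹ * ∫ r in (0 : ℝ)..w, f r := by
    intro f
    rw [average_eq, smul_eq_mul, hμ, measureReal_restrict_apply_univ, Real.volume_real_Ioc_of_le hw.le, sub_zero,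
      intervalIntegral.integral_of_le hw.le]
  filter_upwards [ae_integrableOn_Yobs_flow ha hθ hσ N Φ hφ hφK w] with z hz
  have hJ := ConvexOn.map_average_le (μ := μ) (f := fun r => 𝐘[N, θ₀, φ, Φ.flow r z]) (g := fun y : ℝ => y ^ 2)
    (s := univ) (Even.convexOn_pow (by decide : Even 2)) (continuous_pow 2).continuousOn isClosed_univ
    (Eventually.of_forall fun _ => mem_univ _) hz.1 hz.2
  rw [havg, havg (fun r => 𝐘[N, θ₀, φ, Φ.flow r z] ^ 2)] at hJ
  exact hJ

/-! ## The a-priori bound -/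

/-- **STATIONARY WINDOW ENERGY**: `∫ (w⁻¹∫₀ʷ Y(Φ_r z)² dr) dλ = E_λ[Y²]` (Fubini + invariance of `λ` under every
`Φ_r`). [folklore] -/
theorem integral_windowAvg_Yobs_sq (ha : 0 < a₀) (hθ : 0 < θ₀) (hσ : σ ≤ 1 / 2) (N : ℕ)
    (Φ : HardSphereFlow (Torus.geometry (Fin 3)) (hsDiameter σ N) (N + 1))
    {φ : T3 → ℝ} (hφ : Continuous φ) {K : ℝ} (hφK : ∀ y, |φ y| ≤ K) {w : ℝ} (hw : 0 < w) :
    ∫ z, w⁻¹ * (∫ r in (0 : ℝ)..w, 𝐘[N, θ₀, φ, Φ.flow r z] ^ 2) ∂(localGibbsLaw σ (fun _ => a₀) (fun _ => 0) (fun _ => θ₀) N Φ) =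
      ∫ z, 𝐘[N, θ₀, φ, z] ^ 2 ∂(localGibbsLaw σ (fun _ => a₀) (fun _ => 0) (fun _ => θ₀) N Φ) := by
  haveI : IsProbabilityMeasure (localGibbsLaw σ (fun _ => a₀) (fun _ => (0 : V3)) (fun _ => θ₀) N Φ) :=
    isProbabilityMeasure_localGibbsLaw continuous_const continuous_const continuous_const
      (fun _ => ha) (fun _ => hθ) hσ N Φ
  rw [integral_const_mul, integral_window_eq a₀ θ₀ 0 Φ (X := fun z : Config (N + 1) (Fin 3) T3 => 𝐘[N, θ₀, φ, z] ^ 2)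
    ((measurable_Yobs θ₀ hφ).pow_const 2) (integrable_Yobs_sq ha hθ hσ N Φ hφ hφK) hw.le, ← mul_assoc,
    inv_mul_cancel₀ hw.ne', one_mul]

/-- **A-PRIORI BOUND FOR THE WINDOW-AVERAGED FAST HEAT FLUX** (every `N`, every window `w > 0`, every hard-sphere
flow, `0 < a₀`, `0 < θ₀`, `σ ≤ 1/2`, `|φ| ≤ K`): with `λ = localGibbsLaw σ a₀ 0 θ₀ N Φ` and
`Ȳ(z) = (N+1)⁻¹ Σᵢ w⁻¹∫₀ʷ φ(xᵢ(r)) h_θ₀(vᵢ(r)) dr`,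
`(N+1) · ∫ Ȳ² dλ ≤ K² m₂(θ₀)`.
Proof: linearity, Jensen in time, Fubini + stationarity of `λ`, and the static bound `E_λ[Y²] ≤ K²m₂/(N+1)`
(oddness of `h_θ` kills the equal-time cross terms). In particular the `(N+1)`-normalisation of
`EquilibriumHeatFluxVarianceDecay` is critical: its `limsup_N` is finite for every window. [folklore] -/
theorem succ_mul_lintegral_windowAvg_sq_le (ha : 0 < a₀) (hθ : 0 < θ₀) (hσ : σ ≤ 1 / 2) (N : ℕ)
    (Φ : HardSphereFlow (Torus.geometry (Fin 3)) (hsDiameter σ N) (N + 1))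
    {φ : T3 → ℝ} (hφ : Continuous φ) {K : ℝ} (hφK : ∀ y, |φ y| ≤ K) {w : ℝ} (hw : 0 < w) :
    ((N : ℝ≥0∞) + 1) * ∫⁻ z, ENNReal.ofReal ((((N : ℝ) + 1)⁻¹ * ∑ i : Fin (N + 1), w⁻¹ *
        ∫ r in (0 : ℝ)..w, φ (Φ.flow r z i).1 * ((Φ.flow r z i).2 0 * ‖(Φ.flow r z i).2‖ ^ 2 - 5 * θ₀ * (Φ.flow r z i).2 0)) ^ 2)
        ∂(localGibbsLaw σ (fun _ => a₀) (fun _ => 0) (fun _ => θ₀) N Φ) ≤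
      ENNReal.ofReal (K ^ 2 * 𝐦₂[θ₀]) := by
  haveI : IsProbabilityMeasure (localGibbsLaw σ (fun _ => a₀) (fun _ => (0 : V3)) (fun _ => θ₀) N Φ) :=
    isProbabilityMeasure_localGibbsLaw continuous_const continuous_const continuous_const
      (fun _ => ha) (fun _ => hθ) hσ N Φ
  set G := localGibbsLaw σ (fun _ => a₀) (fun _ => (0 : V3)) (fun _ => θ₀) N Φ with hGdef
  -- Step 1: a.e. comparison of the integrand with the window average of `Y²`
  have hae : ∀ᵐ z ∂G, ENNReal.ofReal ((((N : ℝ) + 1)⁻¹ * ∑ i : Fin (N + 1), w⁻¹ *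
        ∫ r in (0 : ℝ)..w, φ (Φ.flow r z i).1 * ((Φ.flow r z i).2 0 * ‖(Φ.flow r z i).2‖ ^ 2 - 5 * θ₀ * (Φ.flow r z i).2 0)) ^ 2) ≤
      ENNReal.ofReal (w⁻¹ * ∫ r in (0 : ℝ)..w, 𝐘[N, θ₀, φ, Φ.flow r z] ^ 2) := by
    filter_upwards [ae_windowSum_eq ha hθ hσ N Φ hφ hφK hw.le, ae_windowAvg_sq_le ha hθ hσ N Φ hφ hφK hw] with z hz1 hz2
    refine ENNReal.ofReal_le_ofReal ?_
    have e : (((N : ℝ) + 1)⁻¹ * ∑ i : Fin (N + 1), w⁻¹ *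
        ∫ r in (0 : ℝ)..w, φ (Φ.flow r z i).1 * ((Φ.flow r z i).2 0 * ‖(Φ.flow r z i).2‖ ^ 2 - 5 * θ₀ * (Φ.flow r z i).2 0)) =
        w⁻¹ * ∫ r in (0 : ℝ)..w, 𝐘[N, θ₀, φ, Φ.flow r z] := hz1
    rw [e]
    exact hz2
  -- Step 2: integrate, use stationarity and the static bound
  have hnn : 0 ≤ᵐ[G] fun z => w⁻¹ * ∫ r in (0 : ℝ)..w, 𝐘[N, θ₀, φ, Φ.flow r z] ^ 2 :=
    Eventually.of_forall fun z => mul_nonneg (inv_nonneg.2 hw.le)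
      (intervalIntegral.integral_nonneg hw.le fun r _ => sq_nonneg _)
  have hwin : Integrable (fun z => w⁻¹ * ∫ r in (0 : ℝ)..w, 𝐘[N, θ₀, φ, Φ.flow r z] ^ 2) G :=
    (integrable_window a₀ θ₀ 0 Φ ((measurable_Yobs θ₀ hφ).pow_const 2) (integrable_Yobs_sq ha hθ hσ N Φ hφ hφK)
      hw.le).const_mul _
  have hstep : ∫⁻ z, ENNReal.ofReal ((((N : ℝ) + 1)⁻¹ * ∑ i : Fin (N + 1), w⁻¹ *
        ∫ r in (0 : ℝ)..w, φ (Φ.flow r z i).1 * ((Φ.flow r z i).2 0 * ‖(Φ.flow r z i).2‖ ^ 2 - 5 * θ₀ * (Φ.flow r z i).2 0)) ^ 2) ∂G ≤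
      ENNReal.ofReal (((N : ℝ) + 1)⁻¹ * (K ^ 2 * 𝐦₂[θ₀])) := by
    calc ∫⁻ z, ENNReal.ofReal ((((N : ℝ) + 1)⁻¹ * ∑ i : Fin (N + 1), w⁻¹ *
          ∫ r in (0 : ℝ)..w, φ (Φ.flow r z i).1 * ((Φ.flow r z i).2 0 * ‖(Φ.flow r z i).2‖ ^ 2 - 5 * θ₀ * (Φ.flow r z i).2 0)) ^ 2) ∂G
        ≤ ∫⁻ z, ENNReal.ofReal (w⁻¹ * ∫ r in (0 : ℝ)..w, 𝐘[N, θ₀, φ, Φ.flow r z] ^ 2) ∂G := lintegral_mono_ae hae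
      _ = ENNReal.ofReal (∫ z, w⁻¹ * (∫ r in (0 : ℝ)..w, 𝐘[N, θ₀, φ, Φ.flow r z] ^ 2) ∂G) :=
          (ofReal_integral_eq_lintegral_ofReal hwin hnn).symm
      _ = ENNReal.ofReal (∫ z, 𝐘[N, θ₀, φ, z] ^ 2 ∂G) := by rw [integral_windowAvg_Yobs_sq ha hθ hσ N Φ hφ hφK hw]
      _ = ∫⁻ z, ENNReal.ofReal (𝐘[N, θ₀, φ, z] ^ 2) ∂G :=
          ofReal_integral_eq_lintegral_ofReal (integrable_Yobs_sq ha hθ hσ N Φ hφ hφK)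
            (Eventually.of_forall fun z => sq_nonneg _)
      _ ≤ ENNReal.ofReal (((N : ℝ) + 1)⁻¹ * (K ^ 2 * 𝐦₂[θ₀])) := lintegral_Yobs_sq_le ha hθ hσ N Φ hφ hφK
  -- Step 3: multiply by `N + 1`
  have hN : (0 : ℝ) < (N : ℝ) + 1 := by positivity
  have hcast : ((N : ℝ≥0∞) + 1) = ENNReal.ofReal ((N : ℝ) + 1) := by
    rw [ENNReal.ofReal_add (Nat.cast_nonneg N) zero_le_one, ENNReal.ofReal_natCast, ENNReal.ofReal_one]
  calc ((N : ℝ≥0∞) + 1) * ∫⁻ z, ENNReal.ofReal ((((N : ℝ) + 1)⁻¹ * ∑ i : Fin (N + 1), w⁻¹ *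
          ∫ r in (0 : ℝ)..w, φ (Φ.flow r z i).1 * ((Φ.flow r z i).2 0 * ‖(Φ.flow r z i).2‖ ^ 2 - 5 * θ₀ * (Φ.flow r z i).2 0)) ^ 2) ∂G
      ≤ ((N : ℝ≥0∞) + 1) * ENNReal.ofReal (((N : ℝ) + 1)⁻¹ * (K ^ 2 * 𝐦₂[θ₀])) := mul_le_mul_right hstep _
    _ = ENNReal.ofReal (K ^ 2 * 𝐦₂[θ₀]) := by
        rw [hcast, ← ENNReal.ofReal_mul hN.le, ← mul_assoc, mul_inv_cancel₀ hN.ne', one_mul]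

/-! ## Consequences in the shape of the item -/

/-- The kinetic window `w_N = τ (N+1)^{-1/3}` is positive for `τ > 0`. [folklore] -/
theorem window_pos {τ : ℝ} (hτ : 0 < τ) (N : ℕ) : 0 < τ * ((N : ℝ) + 1) ^ (-(1 / 3 : ℝ)) :=
  mul_pos hτ (Real.rpow_pos_of_pos (by positivity) _)

/-- **The `(N+1)`-normalised window variance of the item is bounded uniformly in `N`** (every `τ > 0`, every flow
family, `0 < σ ≤ 1/2`): for `|φ| ≤ K` the `N`-th term of the item's `limsup` is `≤ K² m₂(θ₀)`. [folklore] -/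
theorem item_term_le (ha : 0 < a₀) (hθ : 0 < θ₀) (hσ : σ ≤ 1 / 2)
    (Φ : (N : ℕ) → HardSphereFlow (Torus.geometry (Fin 3)) (hsDiameter σ N) (N + 1))
    {φ : T3 → ℝ} (hφ : Continuous φ) {K : ℝ} (hφK : ∀ y, |φ y| ≤ K) {τ : ℝ} (hτ : 0 < τ) (N : ℕ) :
    ((N : ℝ≥0∞) + 1) * ∫⁻ z, ENNReal.ofReal ((((N : ℝ) + 1)⁻¹ * ∑ i : Fin (N + 1),
        (τ * ((N : ℝ) + 1) ^ (-(1 / 3 : ℝ)))⁻¹ * ∫ r in (0 : ℝ)..(τ * ((N : ℝ) + 1) ^ (-(1 / 3 : ℝ))),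
          φ ((Φ N).flow r z i).1 * (((Φ N).flow r z i).2 0 * ‖((Φ N).flow r z i).2‖ ^ 2 - 5 * θ₀ * ((Φ N).flow r z i).2 0)) ^ 2)
        ∂(localGibbsLaw σ (fun _ => a₀) (fun _ => 0) (fun _ => θ₀) N (Φ N)) ≤
      ENNReal.ofReal (K ^ 2 * 𝐦₂[θ₀]) :=
  succ_mul_lintegral_windowAvg_sq_le ha hθ hσ N (Φ N) hφ hφK (window_pos hτ N)

/-- **`limsup_N` of the item's normalised window variance is finite for every window** `τ > 0` (uniform bound
`K² m₂(θ₀)`, `|φ| ≤ K`): the content of `EquilibriumHeatFluxVarianceDecay` is purely the `τ → ∞` decay. [folklore] -/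
theorem item_limsup_le (ha : 0 < a₀) (hθ : 0 < θ₀) (hσ : σ ≤ 1 / 2)
    (Φ : (N : ℕ) → HardSphereFlow (Torus.geometry (Fin 3)) (hsDiameter σ N) (N + 1))
    {φ : T3 → ℝ} (hφ : Continuous φ) {K : ℝ} (hφK : ∀ y, |φ y| ≤ K) {τ : ℝ} (hτ : 0 < τ) :
    Filter.limsup (fun N : ℕ => ((N : ℝ≥0∞) + 1) * ∫⁻ z, ENNReal.ofReal ((((N : ℝ) + 1)⁻¹ * ∑ i : Fin (N + 1),
        (τ * ((N : ℝ) + 1) ^ (-(1 / 3 : ℝ)))⁻¹ * ∫ r in (0 : ℝ)..(τ * ((N : ℝ) + 1) ^ (-(1 / 3 : ℝ))),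
          φ ((Φ N).flow r z i).1 * (((Φ N).flow r z i).2 0 * ‖((Φ N).flow r z i).2‖ ^ 2 - 5 * θ₀ * ((Φ N).flow r z i).2 0)) ^ 2)
        ∂(localGibbsLaw σ (fun _ => a₀) (fun _ => 0) (fun _ => θ₀) N (Φ N))) Filter.atTop ≤
      ENNReal.ofReal (K ^ 2 * 𝐦₂[θ₀]) :=
  Filter.limsup_le_of_le (h := Eventually.of_forall fun N => item_term_le ha hθ hσ Φ hφ hφK hτ N)

/-- **The item's `limsup_N` is never `⊤`** (every continuous `φ`, every `τ > 0`, `0 < σ ≤ 1/2`). [folklore] -/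
theorem item_limsup_ne_top (ha : 0 < a₀) (hθ : 0 < θ₀) (hσ : σ ≤ 1 / 2)
    (Φ : (N : ℕ) → HardSphereFlow (Torus.geometry (Fin 3)) (hsDiameter σ N) (N + 1))
    {φ : T3 → ℝ} (hφ : Continuous φ) {τ : ℝ} (hτ : 0 < τ) :
    Filter.limsup (fun N : ℕ => ((N : ℝ≥0∞) + 1) * ∫⁻ z, ENNReal.ofReal ((((N : ℝ) + 1)⁻¹ * ∑ i : Fin (N + 1),
        (τ * ((N : ℝ) + 1) ^ (-(1 / 3 : ℝ)))⁻¹ * ∫ r in (0 : ℝ)..(τ * ((N : ℝ) + 1) ^ (-(1 / 3 : ℝ))),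
          φ ((Φ N).flow r z i).1 * (((Φ N).flow r z i).2 0 * ‖((Φ N).flow r z i).2‖ ^ 2 - 5 * θ₀ * ((Φ N).flow r z i).2 0)) ^ 2)
        ∂(localGibbsLaw σ (fun _ => a₀) (fun _ => 0) (fun _ => θ₀) N (Φ N))) Filter.atTop ≠ ⊤ := by
  obtain ⟨K, -, hK⟩ := exists_forall_abs_le_of_continuous hφ
  exact ne_top_of_le_ne_top ENNReal.ofReal_ne_top (item_limsup_le ha hθ hσ Φ hφ hK hτ)

end Apriori

end OneFlightGossipEngineHeatFlux

end Summit.AtomisticToContinuum.HydrodynamicLimit.Theorems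

end
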